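import Mathlib.GroupTheory.Index
import Mathlib.GroupTheory.Commutator.Basic
import Mathlib.Data.SetLike.Fintype
import Mathlib.Order.Preorder.Finite
import HarnessLib

/-!
# Helper `helper_maxCharLevel` of line `prym-layer-stable-rank` for crux
`CongruenceShadows.ShadowsStandard` (item stmt-SmoothPoincare4-14593, route route-SmoothPoincare4-CongruenceShadows)

**Maximal normal subgroups over a maximal characteristic level** (pure group theory).
Let `G` be a group and `M ≤ G` a characteristic subgroup of finite index which is MAXIMAL among the
characteristic subgroups (`M < X` with `X` characteristic forces `X = ⊤`) and has non-abelian
quotient (`¬ ⁅G,G⁆ ≤ M`). Call `P` *maximal normal over `M`* when `P` is normal, `M ≤ P ≠ ⊤`, and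
every normal `Q ⊇ P` is `P` or `⊤` (i.e. `G ⧸ P` is simple). Then

* (ii) every maximal normal `P` over `M` has NON-ABELIAN quotient, `¬ ⁅G,G⁆ ≤ P`
  (so `G ⧸ P` is non-abelian simple);
* (i) the intersection of all maximal normal subgroups over `M` is `M` (stated pointwise: an
  element lying in every such `P` lies in `M`).

Proof. The families `𝓟 = {P maximal normal over M}` and `𝓟_ab = {P ∈ 𝓟 | ⁅G,G⁆ ≤ P}` are stable
under preimages by automorphisms of `G` (`M` and `⁅G,G⁆` are characteristic; maximal normality is
transported by pulling a normal overgroup back along the inverse automorphism), so their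
intersections `R₀`, `R` are characteristic subgroups containing `M`, hence each equals `M` or `⊤`
by maximality of `M`.
(ii): if `P₀ ∈ 𝓟_ab` then `R ≤ P₀ ≠ ⊤`, so `R = M` and `⁅G,G⁆ ≤ R = M`, absurd.
(i): if `R₀ = M` we are done; if `R₀ = ⊤` then `𝓟 = ∅`. But `M ≠ ⊤`, and the normal subgroups `X`
with `M ≤ X ≠ ⊤` form a finite set (they inject into the subgroup lattice of the finite group
`G ⧸ M`) which is nonempty (`M`); a maximal element of it lies in `𝓟`, absurd.

Use in the line: together with Hall's lemma (`helper_hallLemma`, a separate file) this gives the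
"Hall coordinates" `G ⧸ M ≅ ∏_{P ∈ 𝓟} G ⧸ P` of the TOP STRATUM (a level `M` of the surface group
maximal among characteristic finite-index subgroups, with non-abelian quotient) used to assemble the
top-stratum gate of the chief-layer descent of `ShadowsStandard`.

The file declares theorems only; everything here is elementary group theory over an arbitrary
group `G` (no surface groups, no literature input).
-/

set_option linter.dupNamespace false

noncomputable section

namespace Summit.SmoothPoincare4.SmoothPoincare4.Theorems.ShadowsStandard.PrymLayerStableRank

open Subgroup

/-- The intersection `⨅ {P | good P}` of a family of subgroups which is stable under preimages by
automorphisms of `G` is a characteristic subgroup. [folklore] -/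
theorem characteristic_iInf₂_of_comap_stable {G : Type*} [Group G] {good : Subgroup G → Prop}
    (h : ∀ (φ : G ≃* G) (P : Subgroup G), good P → good (P.comap φ.toMonoidHom)) :
    (⨅ (P : Subgroup G) (_ : good P), P).Characteristic := by
  refine Subgroup.characteristic_iff_le_comap.2 fun φ x hx => ?_
  rw [Subgroup.mem_comap, Subgroup.mem_iInf]
  intro P
  rw [Subgroup.mem_iInf]
  intro hP
  rw [Subgroup.mem_iInf] at hx
  have hx' := hx (P.comap φ.toMonoidHom)
  rw [Subgroup.mem_iInf] at hx'
  exact hx' (h φ P hP)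

/-- Over a subgroup `M` that is maximal among characteristic subgroups (`M < X` characteristic
`⟹ X = ⊤`), the intersection of an automorphism-stable family of overgroups of `M` is `M` or `⊤`.
[folklore] -/
theorem iInf₂_eq_or_eq_top_of_maxChar {G : Type*} [Group G] {M : Subgroup G}
    (hmax : ∀ X : Subgroup G, X.Characteristic → M < X → X = ⊤) {good : Subgroup G → Prop}
    (hstab : ∀ (φ : G ≃* G) (P : Subgroup G), good P → good (P.comap φ.toMonoidHom))
    (hle : ∀ P : Subgroup G, good P → M ≤ P) :
    (⨅ (P : Subgroup G) (_ : good P), P) = M ∨ (⨅ (P : Subgroup G) (_ : good P), P) = ⊤ := by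
  have hMR : M ≤ ⨅ (P : Subgroup G) (_ : good P), P := le_iInf₂ hle
  rcases hMR.eq_or_lt with h | h
  · exact Or.inl h.symm
  · exact Or.inr (hmax _ (characteristic_iInf₂_of_comap_stable hstab) h)

/-- A characteristic subgroup below `P` is below every automorphic preimage of `P`. [folklore] -/
theorem le_comap_mulEquiv_of_characteristic {G : Type*} [Group G] {N P : Subgroup G}
    (hN : N.Characteristic) (φ : G ≃* G) (h : N ≤ P) : N ≤ P.comap φ.toMonoidHom :=
  ((Subgroup.characteristic_iff_comap_eq.1 hN) φ).symm.le.trans (Subgroup.comap_mono h)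

/-- The preimage of a proper subgroup under an automorphism is proper. [folklore] -/
theorem comap_mulEquiv_ne_top {G : Type*} [Group G] {P : Subgroup G} (φ : G ≃* G) (hPt : P ≠ ⊤) :
    P.comap φ.toMonoidHom ≠ ⊤ := by
  intro htop
  apply hPt
  rw [eq_top_iff]
  intro y _
  have hy : φ.symm y ∈ P.comap φ.toMonoidHom := by
    rw [htop]
    exact Subgroup.mem_top _
  simpa using hy

/-- **Transport of maximal normality.** If `P` is a maximal proper normal subgroup (every normal
`Q ⊇ P` is `P` or `⊤`), so is its preimage under any automorphism `φ`: pull a normal overgroup `Q`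
of `φ⁻¹(P)` back along `φ⁻¹`. [folklore] -/
theorem maxNormal_comap_mulEquiv {G : Type*} [Group G] {P : Subgroup G} (φ : G ≃* G)
    (hPmax : ∀ Q : Subgroup G, Q.Normal → P ≤ Q → Q = P ∨ Q = ⊤) :
    ∀ Q : Subgroup G, Q.Normal → P.comap φ.toMonoidHom ≤ Q →
      Q = P.comap φ.toMonoidHom ∨ Q = ⊤ := by
  intro Q hQ hPQ
  haveI : Q.Normal := hQ
  have hPQ' : P ≤ Q.comap φ.symm.toMonoidHom := by
    intro x hx
    rw [Subgroup.mem_comap]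
    apply hPQ
    rw [Subgroup.mem_comap]
    simpa using hx
  rcases hPmax (Q.comap φ.symm.toMonoidHom) inferInstance hPQ' with h | h
  · left
    ext y
    constructor
    · intro hy
      rw [Subgroup.mem_comap, ← h, Subgroup.mem_comap]
      simpa using hy
    · intro hy
      rw [Subgroup.mem_comap, ← h, Subgroup.mem_comap] at hy
      simpa using hy
  · right
    rw [eq_top_iff]
    intro y _
    have hy : φ y ∈ Q.comap φ.symm.toMonoidHom := by
      rw [h]
      exact Subgroup.mem_top _
    simpa using hy

/-- **Stability of "maximal normal over `M`" under automorphic preimages.** For `M`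
characteristic and `φ ∈ Aut G`: if `P` is normal, `M ≤ P ≠ ⊤` and `P` is maximal normal, then the
same four properties hold for `φ⁻¹(P) = P.comap φ`. [folklore] -/
theorem maxNormalOver_comap_mulEquiv {G : Type*} [Group G] {M : Subgroup G} (hM : M.Characteristic)
    (φ : G ≃* G) (P : Subgroup G)
    (hP : P.Normal ∧ M ≤ P ∧ P ≠ ⊤ ∧ ∀ Q : Subgroup G, Q.Normal → P ≤ Q → Q = P ∨ Q = ⊤) :
    (P.comap φ.toMonoidHom).Normal ∧ M ≤ P.comap φ.toMonoidHom ∧ P.comap φ.toMonoidHom ≠ ⊤ ∧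
      ∀ Q : Subgroup G, Q.Normal → P.comap φ.toMonoidHom ≤ Q →
        Q = P.comap φ.toMonoidHom ∨ Q = ⊤ := by
  obtain ⟨hPn, hMP, hPt, hPmax⟩ := hP
  haveI : P.Normal := hPn
  exact ⟨inferInstance, le_comap_mulEquiv_of_characteristic hM φ hMP, comap_mulEquiv_ne_top φ hPt,
    maxNormal_comap_mulEquiv φ hPmax⟩

/-- The subgroups containing a finite-index normal subgroup `M` form a finite set: they inject
(`X ↦ X.map (QuotientGroup.mk' M)`, left inverse `comap`) into the subgroup lattice of the finite
group `G ⧸ M`. [folklore] -/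
theorem finite_setOf_normal_finiteIndex_le {G : Type*} [Group G] (M : Subgroup G) [M.Normal]
    [M.FiniteIndex] : Set.Finite {X : Subgroup G | M ≤ X} := by
  refine Set.Finite.of_finite_image (f := fun X : Subgroup G => X.map (QuotientGroup.mk' M))
    (Set.toFinite _) ?_
  intro X hX Y hY hXY
  have e := congrArg (Subgroup.comap (QuotientGroup.mk' M)) hXY
  have hXk : (QuotientGroup.mk' M).ker ≤ X := by rw [QuotientGroup.ker_mk']; exact hX
  have hYk : (QuotientGroup.mk' M).ker ≤ Y := by rw [QuotientGroup.ker_mk']; exact hY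
  simpa only [Subgroup.comap_map_eq_self hXk, Subgroup.comap_map_eq_self hYk] using e

/-- **Maximal normal subgroups over a proper finite-index normal subgroup exist.** If `M` is
normal of finite index and `M ≠ ⊤`, there is a normal `P` with `M ≤ P ≠ ⊤` such that every normal
`Q ⊇ P` is `P` or `⊤`: a maximal element of the finite nonempty set
`{X normal | M ≤ X ≠ ⊤}`. [folklore] -/
theorem exists_maxNormalOver {G : Type*} [Group G] (M : Subgroup G) [M.Normal] [M.FiniteIndex]
    (hMt : M ≠ ⊤) :
    ∃ P : Subgroup G, P.Normal ∧ M ≤ P ∧ P ≠ ⊤ ∧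
      ∀ Q : Subgroup G, Q.Normal → P ≤ Q → Q = P ∨ Q = ⊤ := by
  have hfin : Set.Finite {X : Subgroup G | X.Normal ∧ M ≤ X ∧ X ≠ ⊤} :=
    (finite_setOf_normal_finiteIndex_le M).subset fun X hX => hX.2.1
  have hne : Set.Nonempty {X : Subgroup G | X.Normal ∧ M ≤ X ∧ X ≠ ⊤} :=
    ⟨M, inferInstance, le_rfl, hMt⟩
  obtain ⟨P, ⟨hPn, hMP, hPt⟩, hPmax⟩ := hfin.exists_maximal hne
  refine ⟨P, hPn, hMP, hPt, fun Q hQ hPQ => ?_⟩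
  by_cases hQt : Q = ⊤
  · exact Or.inr hQt
  · exact Or.inl (le_antisymm (hPmax ⟨hQ, hMP.trans hPQ, hQt⟩ hPQ) hPQ)

/-- **REGISTERED HELPER `helper_maxCharLevel`.** For a characteristic finite-index subgroup `M` of
a group `G` which is maximal among characteristic subgroups and has non-abelian quotient
(`¬ ⁅⊤,⊤⁆ ≤ M`): (ii) every maximal normal subgroup `P` over `M` (normal, `M ≤ P ≠ ⊤`, every normal
`Q ⊇ P` equal to `P` or `⊤`) has non-abelian quotient, `¬ ⁅⊤,⊤⁆ ≤ P`; and (i) an element of `G`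
lying in every maximal normal subgroup over `M` lies in `M` (the intersection of the maximal normal
subgroups over `M` is `M`). Both parts: the intersection of an `Aut G`-stable family of overgroups
of `M` is characteristic, hence `M` or `⊤`. [folklore] -/
theorem helper_maxCharLevel :
    ∀ (G : Type) [Group G] (M : Subgroup G), M.Characteristic → M.FiniteIndex →
      (∀ X : Subgroup G, X.Characteristic → M < X → X = ⊤) →
      ¬ ⁅(⊤ : Subgroup G), (⊤ : Subgroup G)⁆ ≤ M →
      (∀ P : Subgroup G, P.Normal → M ≤ P → P ≠ ⊤ →
          (∀ Q : Subgroup G, Q.Normal → P ≤ Q → Q = P ∨ Q = ⊤) →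
          ¬ ⁅(⊤ : Subgroup G), (⊤ : Subgroup G)⁆ ≤ P) ∧
      (∀ x : G, (∀ P : Subgroup G, P.Normal → M ≤ P → P ≠ ⊤ →
          (∀ Q : Subgroup G, Q.Normal → P ≤ Q → Q = P ∨ Q = ⊤) → x ∈ P) → x ∈ M) := by
  intro G _ M hM hMf hmax hab
  haveI : M.Characteristic := hM
  haveI : M.FiniteIndex := hMf
  have hDc : (⁅(⊤ : Subgroup G), (⊤ : Subgroup G)⁆).Characteristic := inferInstance
  refine ⟨?_, ?_⟩
  · -- (ii): the family `𝓟_ab` of maximal normal subgroups over `M` containing `⁅⊤,⊤⁆`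
    intro P₀ hP₀n hMP₀ hP₀t hP₀max habP₀
    have hstab : ∀ (φ : G ≃* G) (P : Subgroup G),
        ((P.Normal ∧ M ≤ P ∧ P ≠ ⊤ ∧ ∀ Q : Subgroup G, Q.Normal → P ≤ Q → Q = P ∨ Q = ⊤) ∧
          ⁅(⊤ : Subgroup G), (⊤ : Subgroup G)⁆ ≤ P) →
        ((P.comap φ.toMonoidHom).Normal ∧ M ≤ P.comap φ.toMonoidHom ∧
            P.comap φ.toMonoidHom ≠ ⊤ ∧ ∀ Q : Subgroup G, Q.Normal → P.comap φ.toMonoidHom ≤ Q →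
              Q = P.comap φ.toMonoidHom ∨ Q = ⊤) ∧
          ⁅(⊤ : Subgroup G), (⊤ : Subgroup G)⁆ ≤ P.comap φ.toMonoidHom :=
      fun φ P hP => ⟨maxNormalOver_comap_mulEquiv hM φ P hP.1,
        le_comap_mulEquiv_of_characteristic hDc φ hP.2⟩
    have hle : ∀ P : Subgroup G,
        ((P.Normal ∧ M ≤ P ∧ P ≠ ⊤ ∧ ∀ Q : Subgroup G, Q.Normal → P ≤ Q → Q = P ∨ Q = ⊤) ∧
          ⁅(⊤ : Subgroup G), (⊤ : Subgroup G)⁆ ≤ P) → M ≤ P :=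
      fun P hP => hP.1.2.1
    have hgood : (P₀.Normal ∧ M ≤ P₀ ∧ P₀ ≠ ⊤ ∧
        ∀ Q : Subgroup G, Q.Normal → P₀ ≤ Q → Q = P₀ ∨ Q = ⊤) ∧
          ⁅(⊤ : Subgroup G), (⊤ : Subgroup G)⁆ ≤ P₀ :=
      ⟨⟨hP₀n, hMP₀, hP₀t, hP₀max⟩, habP₀⟩
    rcases iInf₂_eq_or_eq_top_of_maxChar hmax hstab hle with hR | hR
    · -- `R = M`: then `⁅⊤,⊤⁆ ≤ R = M`
      apply hab
      rw [← hR]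
      exact le_iInf₂ fun P hP => hP.2
    · -- `R = ⊤`: then `⊤ = R ≤ P₀ ≠ ⊤`
      apply hP₀t
      rw [eq_top_iff, ← hR]
      exact iInf₂_le P₀ hgood
  · -- (i): the family `𝓟` of all maximal normal subgroups over `M`
    intro x hx
    have hstab : ∀ (φ : G ≃* G) (P : Subgroup G),
        (P.Normal ∧ M ≤ P ∧ P ≠ ⊤ ∧ ∀ Q : Subgroup G, Q.Normal → P ≤ Q → Q = P ∨ Q = ⊤) →
        ((P.comap φ.toMonoidHom).Normal ∧ M ≤ P.comap φ.toMonoidHom ∧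
            P.comap φ.toMonoidHom ≠ ⊤ ∧ ∀ Q : Subgroup G, Q.Normal → P.comap φ.toMonoidHom ≤ Q →
              Q = P.comap φ.toMonoidHom ∨ Q = ⊤) :=
      fun φ P hP => maxNormalOver_comap_mulEquiv hM φ P hP
    have hle : ∀ P : Subgroup G,
        (P.Normal ∧ M ≤ P ∧ P ≠ ⊤ ∧ ∀ Q : Subgroup G, Q.Normal → P ≤ Q → Q = P ∨ Q = ⊤) →
          M ≤ P :=
      fun P hP => hP.2.1
    rcases iInf₂_eq_or_eq_top_of_maxChar hmax hstab hle with hR | hR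
    · -- `R₀ = M`: `x` lies in every member of `𝓟`, hence in `R₀ = M`
      rw [← hR, Subgroup.mem_iInf]
      intro P
      rw [Subgroup.mem_iInf]
      intro hP
      exact hx P hP.1 hP.2.1 hP.2.2.1 hP.2.2.2
    · -- `R₀ = ⊤`: no maximal normal subgroup over `M` exists, contradicting `M ≠ ⊤`
      exfalso
      have hMt : M ≠ ⊤ := by
        rintro rfl
        exact hab le_top
      obtain ⟨P, hPn, hMP, hPt, hPmax⟩ := exists_maxNormalOver M hMt
      apply hPt
      rw [eq_top_iff, ← hR]
      exact iInf₂_le P ⟨hPn, hMP, hPt, hPmax⟩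

end Summit.SmoothPoincare4.SmoothPoincare4.Theorems.ShadowsStandard.PrymLayerStableRank

end
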